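import Literature.NumberTheory.Transcendental.GaGmSliceMinors
import HarnessLib

/-!
# Nesterenko 2003, Prop. 5.1 — the arithmetic of the assembly (equal degrees → multidegrees)

Topic `Literature/NumberTheory/Transcendental`. The discharge of the named fact
`Literature.NumberTheory.Transcendental.Nesterenko2003_prop51` (Nesterenko 2003, LNM 1819, Prop. 5.1)
combines three inputs: (Z-a) the exact zero estimate with multiplicities on
`𝔾ₐ × 𝔾ₘⁿ ⊂ (ℙ¹)ⁿ⁺¹` at EQUAL torus box degree `K` with the multiplicity `mult_{D₀,K}(H')` of the
obstructing subgroup kept symbolic (`PhilipponZeroEstimateExact.lean`); (Z-b) the general-rank lower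
bound `mult_{D₀,K}(H') ≥ (dim H')!·D₀^{d₀}·K^{n-r}·∑_I |det M'_I|`
(`GaGm.factorial_mul_sum_absMinor_le_mult`, `GaGmSliceMinors.lean`); (Z-c) the isogeny
`y_j ↦ y_j^{k_j}`, `k_j·2D_j = K`, which pulls a polynomial of Laurent multidegree `(D₀, D₁, …, Dₙ)`
back to equal degrees and pushes the obstruction `H'` forward to `H`, scaling the minors by
`|det M_I|·∏_{i∈I} k_i = ι·|det M'_I|` with the same index `ι` that scales the coset count
(`GaGmIsogeny*.lean`). This file PROVES the ℕ-arithmetic that turns these three inequalities into the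
printed one (`GaGm.nesterenko2003_prop51_of_data`): multiply by `K^r = ∏_{i∈I} k_i·2D_i`, use
`∏_{i∈I} D_i · ∏_{j∉I} D_j = D₁⋯Dₙ`, and cancel `K^{n-r}` and `K^r`. No analysis here.

## References

* Yu. V. Nesterenko, *Linear forms in logarithms of rational numbers*, LNM 1819 (2003), §5.1,
  (5.7), (5.9)–(5.11) and Prop. 5.1. [Nesterenko2003]
-/

noncomputable section

open Module Finset

namespace Literature.NumberTheory.Transcendental

namespace GaGm

variable {n : ℕ}

/-- The per-minor identity behind the isogeny reduction: for `#I = r`, `k_i · (2 D_i) = K` and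
`|det M_I|·∏_{i∈I} k_i = ι·|det M'_I|`,
`|det M_I| · ∏_{j∉I} D_j · K^r = ι · |det M'_I| · 2^r · D₁⋯Dₙ`. [cite: Nesterenko2003, §5.1 (5.9)–(5.11)] -/
theorem absMinor_mul_prod_mul_pow {r : ℕ} (M M' : Matrix (Fin r) (Fin n) ℤ) (D : Fin n → ℕ)
    (K : ℕ) (k : Fin n → ℕ) (hk : ∀ j, k j * (2 * D j) = K) (ι : ℕ)
    (c6 : ∀ I : Finset (Fin n), absMinor M I * ∏ i ∈ I, k i = ι * absMinor M' I)
    {I : Finset (Fin n)} (hI : I.card = r) :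
    absMinor M I * (∏ j ∈ Finset.univ \ I, D j) * K ^ r = ι * absMinor M' I * 2 ^ r * ∏ j, D j := by
  have hK : K ^ r = (∏ i ∈ I, k i) * (2 ^ r * ∏ i ∈ I, D i) := by
    rw [← hI, ← Finset.prod_const, ← Finset.prod_const, ← Finset.prod_mul_distrib, ← Finset.prod_mul_distrib]
    exact Finset.prod_congr rfl fun i _ => (hk i).symm
  have hP : (∏ i ∈ I, D i) * ∏ j ∈ Finset.univ \ I, D j = ∏ j, D j :=
    Finset.prod_mul_prod_compl I D ▸ by rw [Finset.compl_eq_univ_sdiff]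
  calc absMinor M I * (∏ j ∈ Finset.univ \ I, D j) * K ^ r
      = (absMinor M I * ∏ i ∈ I, k i) * 2 ^ r * ((∏ i ∈ I, D i) * ∏ j ∈ Finset.univ \ I, D j) := by
        rw [hK]; ring
    _ = ι * absMinor M' I * 2 ^ r * ∏ j, D j := by rw [c6 I, hP]

/-- **Prop. 5.1 from the three inputs (non-degenerate degrees).** Given the data delivered by the
isogeny package — the obstructing irreducible subgroup `H'` upstairs with a `ℤ`-basis `M'` of its
characters, the pushed-forward connected subgroup `H` downstairs with a `ℤ`-basis `M`, the common
index `ι`, the degree data `k_j·(2D_j) = K`, equal additive parts, `dim H' ≤ n`, the codimension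
`ℓ₀`, the minors scaling, and the exact zero-estimate inequality at box degrees `(D₀, K)` with
`mult_{D₀,K}(H')` symbolic — the inequality of Nesterenko's Prop. 5.1 holds for `H, r, M`.
[cite: Nesterenko2003, Prop 5.1] -/
theorem nesterenko2003_prop51_of_data (D₀ S₀ : ℕ) (D : Fin n → ℕ) (hD₀ : 1 ≤ D₀)
    (W : Submodule ℂ (ℂ × (Fin n → ℂ))) (S : Set (GaGm n))
    (K : ℕ) (hK : 1 ≤ K) (k : Fin n → ℕ) (hk : ∀ j, k j * (2 * D j) = K)
    (H' : Subgroup (GaGm n)) (hirr' : IsIrred (H' : Set (GaGm n))) (H : ConnAlgSubgroup n) (r : ℕ)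
    (M M' : Matrix (Fin r) (Fin n) ℤ) (ι ℓ₀ : ℕ)
    (c1 : LinearIndependent ℤ (fun i => M i))
    (c1' : H.chars = AddSubgroup.closure (Set.range fun i => M i))
    (c2 : LinearIndependent ℤ (fun i => M' i))
    (c2' : charGroup (H' : Set (GaGm n)) = AddSubgroup.closure (Set.range fun i => M' i))
    (c3 : H.addDim = (toConnAlgSubgroup H' hirr').addDim)
    (c4 : dimG (H' : Set (GaGm n)) ≤ n)
    (c5 : Module.finrank ℂ W - Module.finrank ℂ ↥(W ⊓ H.tangent) = ℓ₀)
    (c6 : ∀ I : Finset (Fin n), absMinor M I * ∏ i ∈ I, k i = ι * absMinor M' I)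
    (c7 : (S₀ + ℓ₀).choose ℓ₀ * Set.ncard ((QuotientGroup.mk : GaGm n → GaGm n ⧸ H.toSubgroup) '' S) * ι *
        mult D₀ K (H' : Set (GaGm n)) ≤ (n + 1).factorial * D₀ * K ^ n) :
    ∃ (H : ConnAlgSubgroup n) (r : ℕ) (M : Matrix (Fin r) (Fin n) ℤ),
      LinearIndependent ℤ (fun i => M i) ∧
      H.chars = AddSubgroup.closure (Set.range fun i => M i) ∧
      H.addDim + (n - r) ≤ n ∧
      Nat.choose (S₀ + (Module.finrank ℂ W - Module.finrank ℂ ↥(W ⊓ H.tangent)))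
          (Module.finrank ℂ W - Module.finrank ℂ ↥(W ⊓ H.tangent)) *
        Set.ncard ((QuotientGroup.mk : GaGm n → GaGm n ⧸ H.toSubgroup) '' S) *
        nesterenkoH n r H.addDim M D₀ D ≤ (n + 1).factorial * 2 ^ n * D₀ * ∏ j, D j := by
  classical
  -- dimensions upstairs
  have hrk : r + (toConnAlgSubgroup H' hirr').torusDim = n := basis_card_add_torusDim_eq H' hirr' c2 c2'
  have hdim : dimG (H' : Set (GaGm n)) = (toConnAlgSubgroup H' hirr').addDim + (toConnAlgSubgroup H' hirr').torusDim :=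
    dimG_eq_addDim_add_torusDim H' hirr'
  set a := (toConnAlgSubgroup H' hirr').addDim with ha
  set k' := (toConnAlgSubgroup H' hirr').torusDim with hk'
  have hnr : n - r = k' := by omega
  refine ⟨H, r, M, c1, c1', by rw [c3, hnr]; omega, ?_⟩
  rw [c5, c3]
  -- abbreviations
  set C : ℕ := (S₀ + ℓ₀).choose ℓ₀ * Set.ncard ((QuotientGroup.mk : GaGm n → GaGm n ⧸ H.toSubgroup) '' S) with hC
  set Smin : ℕ := ∑ I ∈ (Finset.univ : Finset (Fin n)).powersetCard r, absMinor M' I with hSmin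
  set P : ℕ := ∏ j, D j with hP
  -- (Z-b) at box degrees `(D₀, K)` for the basis `M'`
  have hZb : (a + k').factorial * (D₀ ^ a * (K ^ k' * Smin)) ≤ mult D₀ K (H' : Set (GaGm n)) := by
    have h := factorial_mul_sum_absMinor_le_mult hD₀ hK H' hirr' c2 c2'
    rwa [hdim] at h
  -- combine with (Z-a)/(Z-c)
  have h1 : C * ι * ((a + k').factorial * (D₀ ^ a * (K ^ k' * Smin))) ≤ (n + 1).factorial * D₀ * K ^ n :=
    (Nat.mul_le_mul_left _ hZb).trans c7
  -- cancel `K ^ k'`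
  have hKpos : 0 < K := hK
  have h2 : C * ι * (a + k').factorial * D₀ ^ a * Smin ≤ (n + 1).factorial * D₀ * K ^ r := by
    refine Nat.le_of_mul_le_mul_right ?_ (pow_pos hKpos k')
    calc C * ι * (a + k').factorial * D₀ ^ a * Smin * K ^ k'
        = C * ι * ((a + k').factorial * (D₀ ^ a * (K ^ k' * Smin))) := by ring
      _ ≤ (n + 1).factorial * D₀ * K ^ n := h1
      _ = (n + 1).factorial * D₀ * K ^ r * K ^ k' := by rw [← hrk, pow_add]; ring
  -- the obstruction polynomial times `K ^ r`
  have h3 : nesterenkoH n r a M D₀ D * K ^ r = (a + k').factorial * 2 ^ n * D₀ ^ a * (ι * P * Smin) := by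
    have hsum : (∑ I ∈ (Finset.univ : Finset (Fin n)).powersetCard r,
        absMinor M I * ∏ j ∈ Finset.univ \ I, D j) * K ^ r = ι * 2 ^ r * P * Smin := by
      rw [Finset.sum_mul, hSmin, Finset.mul_sum]
      refine Finset.sum_congr rfl fun I hI => ?_
      rw [absMinor_mul_prod_mul_pow M M' D K k hk ι c6 (Finset.mem_powersetCard.mp hI).2]
      ring
    have h2n : 2 ^ n = 2 ^ k' * 2 ^ r := by rw [← pow_add, add_comm, hrk]
    rw [nesterenkoH, hnr]
    calc (a + k').factorial * 2 ^ k' * D₀ ^ a *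
          (∑ I ∈ (Finset.univ : Finset (Fin n)).powersetCard r, absMinor M I * ∏ j ∈ Finset.univ \ I, D j) * K ^ r
        = (a + k').factorial * 2 ^ k' * D₀ ^ a *
          ((∑ I ∈ (Finset.univ : Finset (Fin n)).powersetCard r, absMinor M I * ∏ j ∈ Finset.univ \ I, D j) * K ^ r) := by
          ring
      _ = (a + k').factorial * 2 ^ k' * D₀ ^ a * (ι * 2 ^ r * P * Smin) := by rw [hsum]
      _ = (a + k').factorial * 2 ^ n * D₀ ^ a * (ι * P * Smin) := by rw [h2n]; ring
  -- conclude by cancelling `K ^ r`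
  refine Nat.le_of_mul_le_mul_right ?_ (pow_pos hKpos r)
  calc C * nesterenkoH n r a M D₀ D * K ^ r
      = C * (nesterenkoH n r a M D₀ D * K ^ r) := by ring
    _ = 2 ^ n * P * (C * ι * (a + k').factorial * D₀ ^ a * Smin) := by rw [h3]; ring
    _ ≤ 2 ^ n * P * ((n + 1).factorial * D₀ * K ^ r) := Nat.mul_le_mul_left _ h2
    _ = (n + 1).factorial * 2 ^ n * D₀ * P * K ^ r := by ring

end GaGm

end Literature.NumberTheory.Transcendental
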